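import Mathlib
import Summits.Ventures.PercRepro2.Defs
import Summits.Ventures.PercRepro2.Harris
import Summits.Ventures.PercRepro2.Graph
import Summits.Ventures.PercRepro2.Events
import Summits.Ventures.PercRepro2.TReduction
import Summits.Ventures.PercRepro2.TReductionBase

/-!
# The (T) form from the one-edge cross-minimum inequalities (blind cell PercRepro2, mine-a g43)

Two reductions of the cell's three-event inequality (T) (`0 ≤ gform Q U e p p`, TReduction.lean) to
a *one-edge* statement, in the vocabulary of the antipodal sums `kform`:

* **Pointwise (QC).**  For a free edge `g` write `T₀ = K_∅(p[g↦0])`, `T₁ = K_∅(p[g↦1])` and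
  `Φ = K_{{g}}(p)` (the symmetrised cross form of the `g`-open and `g`-closed worlds).  The pinning
  identity is `T(p) = (1 − t)² T₀ + t (1 − t) Φ + t² T₁` (`t = p g`).  If always
  `2 · min(T₀, T₁) ≤ Φ`, then `T(p) ≥ min(T₀, T₁)` — the one-edge polynomial never dips below its
  endpoint values — and by induction on the free edges `T(p) ≥ 0` (`tform_nonneg_of_crossMin`).
  Equivalently: along each edge weight `T` is never convex with an interior minimum.
* **Antipodal (2MIN).**  For a base case `K_D(a)` (`a` `0/1` off `D`) and `g ∈ D`, with
  `K₀ = K_{D∖g}(a[g↦0])` (`g` deleted) and `K₁ = K_{D∖g}(a[g↦1])` (`g` contracted): if always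
  `2 · min(K₀, K₁) ≤ K_D(a)`, every base case is nonnegative (`kform_nonneg_of_twoMin`), hence
  (T) for every admissible weight vector (`tform_nonneg_of_twoMin`, `t_cluster_of_twoMin`).

Both hypotheses are the candidate lemmas of record of MINE-A.md §98 (exhaustive on all connected
multigraphs with `≤ 5` vertices and `≤ 8` edges, every marking, every edge; equality at pendant
edges).  Nothing here uses the graph: pure algebra of `kform_pin`.  No instance, no notation.
-/

namespace Summit.Ventures.PercRepro2

namespace TReduction

open Finset

section CrossMin

variable {E : Type*} [Fintype E] [DecidableEq E] {R : Type*} [Field R] [LinearOrder R]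
  [IsStrictOrderedRing R]

/-- **The one-edge bound**: for admissible `p` and any `g`, `T(p) ≥ min(T₀, T₁)` as soon as the
cross form `Φ = K_{{g}}(p)` is at least `2 · min(T₀, T₁)` (`T₀ = K_∅(p[g↦0])`, `T₁ = K_∅(p[g↦1])`). -/
lemma kform_empty_ge_min_of_crossMin (Q U e : Set (Config E)) (p : E → R) (hp : IsProbVec p)
    (g : E)
    (hcross : 2 * min (kform Q U e ∅ (Function.update p g 0))
        (kform Q U e ∅ (Function.update p g 1)) ≤ kform Q U e {g} p) :
    min (kform Q U e ∅ (Function.update p g 0)) (kform Q U e ∅ (Function.update p g 1)) ≤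
      kform Q U e ∅ p := by
  have hpin := kform_pin Q U e (D := ∅) (g := g) (notMem_empty g) p
  rw [insert_empty] at hpin
  set T₀ := kform Q U e ∅ (Function.update p g 0)
  set T₁ := kform Q U e ∅ (Function.update p g 1)
  set Φ := kform Q U e {g} p
  set μ := min T₀ T₁
  have h0 : μ ≤ T₀ := min_le_left _ _
  have h1 : μ ≤ T₁ := min_le_right _ _
  have ht0 : 0 ≤ p g := hp.nonneg g
  have ht1 : 0 ≤ 1 - p g := sub_nonneg.2 (hp.le_one g)
  rw [hpin]
  have e1 : μ = (1 - p g) ^ 2 * μ + p g ^ 2 * μ + p g * (1 - p g) * (2 * μ) := by ring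
  rw [e1]
  gcongr

/-- **(T) from the pointwise cross-minimum inequality (QC)**: if for every admissible `p` and every
free edge `g` the cross form satisfies `2 · min(K_∅(p[g↦0]), K_∅(p[g↦1])) ≤ K_{{g}}(p)`, then
`K_∅(p) = gform p p ≥ 0` for every admissible `p`. -/
theorem kform_empty_nonneg_of_crossMin (Q U e : Set (Config E))
    (hcross : ∀ (p : E → R), IsProbVec p → ∀ g : E, p g ≠ 0 → p g ≠ 1 →
      2 * min (kform Q U e ∅ (Function.update p g 0))
        (kform Q U e ∅ (Function.update p g 1)) ≤ kform Q U e {g} p) :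
    ∀ (p : E → R), IsProbVec p → 0 ≤ kform Q U e ∅ p := by
  suffices h : ∀ n : ℕ, ∀ (p : E → R), IsProbVec p → (freeEdges ∅ p).card = n →
      0 ≤ kform Q U e ∅ p from fun p hp => h _ p hp rfl
  intro n
  induction n with
  | zero =>
    intro p hp hn
    -- no free edge: `p` is `0/1`-valued, the form is the combinatorial sum over `suppOn ∅` and vanishes
    have ha : ∀ x, x ∉ (∅ : Finset E) → p x = 0 ∨ p x = 1 := by
      intro x _
      by_cases h0 : p x = 0
      · exact Or.inl h0
      by_cases h1 : p x = 1
      · exact Or.inr h1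
      exfalso
      have hmem : x ∈ freeEdges ∅ p := mem_freeEdges.2 ⟨notMem_empty x, h0, h1⟩
      rw [card_eq_zero] at hn
      rw [hn] at hmem
      exact notMem_empty x hmem
    rw [kform_eq_antipodal_sum Q U e ha]
    apply le_of_eq
    symm
    apply sum_eq_zero
    intro σ _
    have hb : (baseConfig p ∅ fun x => !σ x) = baseConfig p ∅ σ := by
      funext x
      simp [baseConfig]
    rw [hb]
    simp
  | succ n ih =>
    intro p hp hn
    obtain ⟨g, hg⟩ : (freeEdges ∅ p).Nonempty := by
      rw [← card_pos, hn]; exact Nat.succ_pos n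
    obtain ⟨-, hg0, hg1⟩ := mem_freeEdges.1 hg
    have hcard : ((freeEdges ∅ p).erase g).card = n := by
      rw [card_erase_of_mem hg, hn]; rfl
    have h0 : 0 ≤ kform Q U e ∅ (Function.update p g 0) :=
      ih _ (hp.update g le_rfl zero_le_one) (by rw [freeEdges_update ∅ p hg (Or.inl rfl), hcard])
    have h1 : 0 ≤ kform Q U e ∅ (Function.update p g 1) :=
      ih _ (hp.update g zero_le_one le_rfl) (by rw [freeEdges_update ∅ p hg (Or.inr rfl), hcard])
    have hmin := kform_empty_ge_min_of_crossMin Q U e p hp g (hcross p hp g hg0 hg1)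
    exact le_trans (le_min h0 h1) hmin

/-- **(T) for arbitrary events from (QC)**: `P(Q∩U) P(e) + P(Q∩e) P(U) ≤ P(Q∩U∩e) + P(Q) P(U∩e)`
for every admissible `p`, as soon as the pointwise cross-minimum inequality holds. -/
theorem tform_nonneg_of_crossMin (Q U e : Set (Config E))
    (hcross : ∀ (p : E → R), IsProbVec p → ∀ g : E, p g ≠ 0 → p g ≠ 1 →
      2 * min (kform Q U e ∅ (Function.update p g 0))
        (kform Q U e ∅ (Function.update p g 1)) ≤ kform Q U e {g} p)
    (p : E → R) (hp : IsProbVec p) :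
    prob p (Q ∩ U) * prob p e + prob p (Q ∩ e) * prob p U ≤
      prob p (Q ∩ U ∩ e) + prob p Q * prob p (U ∩ e) := by
  have h := kform_empty_nonneg_of_crossMin Q U e hcross p hp
  rw [kform_empty] at h
  unfold gform at h
  linarith

end CrossMin

section TwoMin

variable {E : Type*} [Fintype E] [DecidableEq E] {R : Type*} [Field R] [LinearOrder R]
  [IsStrictOrderedRing R]

omit [IsStrictOrderedRing R] in
/-- A base case with `D = ∅` vanishes: the two copies coincide. -/
lemma kform_empty_of_zero_one (Q U e : Set (Config E)) {a : E → R}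
    (ha : ∀ x, a x = 0 ∨ a x = 1) : kform Q U e ∅ a = 0 := by
  rw [kform_eq_antipodal_sum Q U e (D := ∅) (fun x _ => ha x)]
  apply sum_eq_zero
  intro σ _
  have hb : (baseConfig a ∅ fun x => !σ x) = baseConfig a ∅ σ := by
    funext x
    simp [baseConfig]
  rw [hb]
  simp

/-- **Every antipodal base case is nonnegative from (2MIN)**: if for every base case `K_D(a)`
(`a` admissible, `0/1` off `D`) and every `g ∈ D`, `K_D(a)` is at least twice the smaller of the two
minors `K_{D∖g}(a[g↦0])` (`g` deleted) and `K_{D∖g}(a[g↦1])` (`g` contracted), then every base case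
is nonnegative. -/
theorem kform_nonneg_of_twoMin (Q U e : Set (Config E))
    (htwo : ∀ (D : Finset E) (a : E → R), IsProbVec a → (∀ x, x ∉ D → a x = 0 ∨ a x = 1) →
      ∀ g ∈ D, 2 * min (kform Q U e (D.erase g) (Function.update a g 0))
        (kform Q U e (D.erase g) (Function.update a g 1)) ≤ kform Q U e D a) :
    ∀ (D : Finset E) (a : E → R), IsProbVec a → (∀ x, x ∉ D → a x = 0 ∨ a x = 1) →
      0 ≤ kform Q U e D a := by
  intro D
  induction D using Finset.strongInduction with
  | H D ih =>
    intro a ha hzo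
    rcases D.eq_empty_or_nonempty with hD | ⟨g, hg⟩
    · subst hD
      rw [kform_empty_of_zero_one Q U e (fun x => hzo x (notMem_empty x))]
    · have herase : D.erase g ⊂ D := erase_ssubset hg
      have hz0 : ∀ x, x ∉ D.erase g → Function.update a g 0 x = 0 ∨ Function.update a g 0 x = 1 := by
        intro x hx
        by_cases hxg : x = g
        · subst hxg; simp
        · rw [Function.update_of_ne hxg]
          exact hzo x (fun hxD => hx (mem_erase.2 ⟨hxg, hxD⟩))
      have hz1 : ∀ x, x ∉ D.erase g → Function.update a g 1 x = 0 ∨ Function.update a g 1 x = 1 := by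
        intro x hx
        by_cases hxg : x = g
        · subst hxg; simp
        · rw [Function.update_of_ne hxg]
          exact hzo x (fun hxD => hx (mem_erase.2 ⟨hxg, hxD⟩))
      have h0 := ih _ herase _ (ha.update g le_rfl zero_le_one) hz0
      have h1 := ih _ herase _ (ha.update g zero_le_one le_rfl) hz1
      have h := htwo D a ha hzo g hg
      have hmin : 0 ≤ min (kform Q U e (D.erase g) (Function.update a g 0))
          (kform Q U e (D.erase g) (Function.update a g 1)) := le_min h0 h1
      linarith

/-- **(T) for arbitrary events from (2MIN)** on the antipodal base cases. -/
theorem tform_nonneg_of_twoMin (Q U e : Set (Config E))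
    (htwo : ∀ (D : Finset E) (a : E → R), IsProbVec a → (∀ x, x ∉ D → a x = 0 ∨ a x = 1) →
      ∀ g ∈ D, 2 * min (kform Q U e (D.erase g) (Function.update a g 0))
        (kform Q U e (D.erase g) (Function.update a g 1)) ≤ kform Q U e D a)
    (p : E → R) (hp : IsProbVec p) :
    prob p (Q ∩ U) * prob p e + prob p (Q ∩ e) * prob p U ≤
      prob p (Q ∩ U ∩ e) + prob p Q * prob p (U ∩ e) :=
  tform_nonneg_of_base Q U e (kform_nonneg_of_twoMin Q U e htwo) p hp

end TwoMin

section Cluster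

variable {V : Type*} [Fintype V] [DecidableEq V] {E : Type*} [Fintype E] [DecidableEq E]
  {R : Type*} [Field R] [LinearOrder R] [IsStrictOrderedRing R]

omit [Fintype V] [DecidableEq V] in
/-- **(T_h) for cluster events from (2MIN)**: the shape of `t_cluster_of_antipodal_base`, with the
base-case hypothesis replaced by the one-edge cross-minimum inequality on the antipodal sums of the
three cluster events `Q = {h ∈ C_s}`, `U = {C_s ∈ 𝓤}`, `e = {C_s ∈ 𝓥}`. -/
theorem t_cluster_of_twoMin (p : E → R) (hp : IsProbVec p) (ends : E → Sym2 V) (s h : V)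
    (𝓤 𝓥 : Set (Set V))
    (htwo : ∀ (D : Finset E) (a : E → R), IsProbVec a → (∀ x, x ∉ D → a x = 0 ∨ a x = 1) →
      ∀ g ∈ D, 2 * min (kform (clusterInEvent ends s {T : Set V | h ∈ T}) (clusterInEvent ends s 𝓤)
          (clusterInEvent ends s 𝓥) (D.erase g) (Function.update a g 0))
        (kform (clusterInEvent ends s {T : Set V | h ∈ T}) (clusterInEvent ends s 𝓤)
          (clusterInEvent ends s 𝓥) (D.erase g) (Function.update a g 1)) ≤
        kform (clusterInEvent ends s {T : Set V | h ∈ T}) (clusterInEvent ends s 𝓤)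
          (clusterInEvent ends s 𝓥) D a) :
    let Q := clusterInEvent ends s {T : Set V | h ∈ T}
    let U := clusterInEvent ends s 𝓤
    let e := clusterInEvent ends s 𝓥
    prob p (Q ∩ U) * prob p e + prob p U * prob p (Q ∩ e) ≤
      prob p (Q ∩ U ∩ e) + prob p Q * prob p (U ∩ e) := by
  intro Q U e
  have h := tform_nonneg_of_twoMin Q U e htwo p hp
  linarith [mul_comm (prob p U) (prob p (Q ∩ e))]

end Cluster

section Min

variable {E : Type*} [Fintype E] [DecidableEq E] {R : Type*} [Field R] [LinearOrder R]
  [IsStrictOrderedRing R]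

/-!
### The minimum inequalities (appended by mine-a g43 after the kit census j326406 / j326407)

The hypothesis (2MIN) of `kform_nonneg_of_twoMin` is FALSE in general (all connected multigraphs with
6 vertices and 8 edges: 720 violations among 169,631,280 base-case instances; 7 vertices, 9 edges:
61,920 / 7,698,125,988), so that theorem is a reduction from a refuted hypothesis.  What the census
supports is the weaker **(MIN)**: `min(K₀, K₁) ≤ K_D(a)` (0 violations on 9,246,631,044 instances with
7 vertices and on every smaller census), and pointwise **(PMIN)** `min(T₀, T₁) ≤ Φ` (adversarial
weights).  Both still give (T) by the same inductions: `K_D(a) ≥ min(K₀, K₁) ≥ 0`, and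
`T(p) ≥ (1 − t + t²) · min(T₀, T₁) ≥ 0`.
-/

/-- **Every antipodal base case is nonnegative from (MIN)**: if every base case `K_D(a)` is at least
the smaller of its two minors `K_{D∖g}(a[g↦0])`, `K_{D∖g}(a[g↦1])` at every `g ∈ D`, every base
case is nonnegative. -/
theorem kform_nonneg_of_min (Q U e : Set (Config E))
    (hmin : ∀ (D : Finset E) (a : E → R), IsProbVec a → (∀ x, x ∉ D → a x = 0 ∨ a x = 1) →
      ∀ g ∈ D, min (kform Q U e (D.erase g) (Function.update a g 0))
        (kform Q U e (D.erase g) (Function.update a g 1)) ≤ kform Q U e D a) :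
    ∀ (D : Finset E) (a : E → R), IsProbVec a → (∀ x, x ∉ D → a x = 0 ∨ a x = 1) →
      0 ≤ kform Q U e D a := by
  intro D
  induction D using Finset.strongInduction with
  | H D ih =>
    intro a ha hzo
    rcases D.eq_empty_or_nonempty with hD | ⟨g, hg⟩
    · subst hD
      rw [kform_empty_of_zero_one Q U e (fun x => hzo x (notMem_empty x))]
    · have herase : D.erase g ⊂ D := erase_ssubset hg
      have hz0 : ∀ x, x ∉ D.erase g → Function.update a g 0 x = 0 ∨ Function.update a g 0 x = 1 := by
        intro x hx
        by_cases hxg : x = g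
        · subst hxg; simp
        · rw [Function.update_of_ne hxg]
          exact hzo x (fun hxD => hx (mem_erase.2 ⟨hxg, hxD⟩))
      have hz1 : ∀ x, x ∉ D.erase g → Function.update a g 1 x = 0 ∨ Function.update a g 1 x = 1 := by
        intro x hx
        by_cases hxg : x = g
        · subst hxg; simp
        · rw [Function.update_of_ne hxg]
          exact hzo x (fun hxD => hx (mem_erase.2 ⟨hxg, hxD⟩))
      have h0 := ih _ herase _ (ha.update g le_rfl zero_le_one) hz0
      have h1 := ih _ herase _ (ha.update g zero_le_one le_rfl) hz1
      exact le_trans (le_min h0 h1) (hmin D a ha hzo g hg)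

/-- **(T) for arbitrary events from (MIN)** on the antipodal base cases. -/
theorem tform_nonneg_of_min (Q U e : Set (Config E))
    (hmin : ∀ (D : Finset E) (a : E → R), IsProbVec a → (∀ x, x ∉ D → a x = 0 ∨ a x = 1) →
      ∀ g ∈ D, min (kform Q U e (D.erase g) (Function.update a g 0))
        (kform Q U e (D.erase g) (Function.update a g 1)) ≤ kform Q U e D a)
    (p : E → R) (hp : IsProbVec p) :
    prob p (Q ∩ U) * prob p e + prob p (Q ∩ e) * prob p U ≤
      prob p (Q ∩ U ∩ e) + prob p Q * prob p (U ∩ e) :=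
  tform_nonneg_of_base Q U e (kform_nonneg_of_min Q U e hmin) p hp

/-- **The pointwise minimum bound**: `T(p) ≥ (1 − t + t²) · min(T₀, T₁)` (`t = p g`) as soon as
`min(T₀, T₁) ≤ Φ = K_{{g}}(p)`. -/
lemma kform_empty_ge_of_pmin (Q U e : Set (Config E)) (p : E → R) (hp : IsProbVec p) (g : E)
    (hcross : min (kform Q U e ∅ (Function.update p g 0))
        (kform Q U e ∅ (Function.update p g 1)) ≤ kform Q U e {g} p) :
    (1 - p g + p g ^ 2) * min (kform Q U e ∅ (Function.update p g 0))
        (kform Q U e ∅ (Function.update p g 1)) ≤ kform Q U e ∅ p := by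
  have hpin := kform_pin Q U e (D := ∅) (g := g) (notMem_empty g) p
  rw [insert_empty] at hpin
  set T₀ := kform Q U e ∅ (Function.update p g 0)
  set T₁ := kform Q U e ∅ (Function.update p g 1)
  set Φ := kform Q U e {g} p
  set μ := min T₀ T₁
  have h0 : μ ≤ T₀ := min_le_left _ _
  have h1 : μ ≤ T₁ := min_le_right _ _
  have ht0 : 0 ≤ p g := hp.nonneg g
  have ht1 : 0 ≤ 1 - p g := sub_nonneg.2 (hp.le_one g)
  rw [hpin]
  have e1 : (1 - p g + p g ^ 2) * μ = (1 - p g) ^ 2 * μ + p g ^ 2 * μ + p g * (1 - p g) * μ := by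
    ring
  rw [e1]
  gcongr

/-- **(T) from the pointwise minimum inequality (PMIN)**: if for every admissible `p` and every free
edge `g`, `min(K_∅(p[g↦0]), K_∅(p[g↦1])) ≤ K_{{g}}(p)`, then `K_∅(p) = gform p p ≥ 0`. -/
theorem kform_empty_nonneg_of_pmin (Q U e : Set (Config E))
    (hcross : ∀ (p : E → R), IsProbVec p → ∀ g : E, p g ≠ 0 → p g ≠ 1 →
      min (kform Q U e ∅ (Function.update p g 0))
        (kform Q U e ∅ (Function.update p g 1)) ≤ kform Q U e {g} p) :
    ∀ (p : E → R), IsProbVec p → 0 ≤ kform Q U e ∅ p := by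
  suffices h : ∀ n : ℕ, ∀ (p : E → R), IsProbVec p → (freeEdges ∅ p).card = n →
      0 ≤ kform Q U e ∅ p from fun p hp => h _ p hp rfl
  intro n
  induction n with
  | zero =>
    intro p hp hn
    have ha : ∀ x, p x = 0 ∨ p x = 1 := by
      intro x
      by_cases h0 : p x = 0
      · exact Or.inl h0
      by_cases h1 : p x = 1
      · exact Or.inr h1
      exfalso
      have hmem : x ∈ freeEdges ∅ p := mem_freeEdges.2 ⟨notMem_empty x, h0, h1⟩
      rw [card_eq_zero] at hn
      rw [hn] at hmem
      exact notMem_empty x hmem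
    rw [kform_empty_of_zero_one Q U e ha]
  | succ n ih =>
    intro p hp hn
    obtain ⟨g, hg⟩ : (freeEdges ∅ p).Nonempty := by
      rw [← card_pos, hn]; exact Nat.succ_pos n
    obtain ⟨-, hg0, hg1⟩ := mem_freeEdges.1 hg
    have hcard : ((freeEdges ∅ p).erase g).card = n := by
      rw [card_erase_of_mem hg, hn]; rfl
    have h0 : 0 ≤ kform Q U e ∅ (Function.update p g 0) :=
      ih _ (hp.update g le_rfl zero_le_one) (by rw [freeEdges_update ∅ p hg (Or.inl rfl), hcard])
    have h1 : 0 ≤ kform Q U e ∅ (Function.update p g 1) :=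
      ih _ (hp.update g zero_le_one le_rfl) (by rw [freeEdges_update ∅ p hg (Or.inr rfl), hcard])
    have hge := kform_empty_ge_of_pmin Q U e p hp g (hcross p hp g hg0 hg1)
    have hc : 0 ≤ 1 - p g + p g ^ 2 := by nlinarith [hp.nonneg g, hp.le_one g, sq_nonneg (p g)]
    exact le_trans (mul_nonneg hc (le_min h0 h1)) hge

/-- **(T) for arbitrary events from (PMIN)**. -/
theorem tform_nonneg_of_pmin (Q U e : Set (Config E))
    (hcross : ∀ (p : E → R), IsProbVec p → ∀ g : E, p g ≠ 0 → p g ≠ 1 →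
      min (kform Q U e ∅ (Function.update p g 0))
        (kform Q U e ∅ (Function.update p g 1)) ≤ kform Q U e {g} p)
    (p : E → R) (hp : IsProbVec p) :
    prob p (Q ∩ U) * prob p e + prob p (Q ∩ e) * prob p U ≤
      prob p (Q ∩ U ∩ e) + prob p Q * prob p (U ∩ e) := by
  have h := kform_empty_nonneg_of_pmin Q U e hcross p hp
  rw [kform_empty] at h
  unfold gform at h
  linarith

end Min

end TReduction

end Summit.Ventures.PercRepro2
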